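import Summits.AtomisticToContinuum.Crystallization.Theorems.ExcessDecayLiouvilleLongRange
import Summits.AtomisticToContinuum.Crystallization.Theorems.ExcessDecayLiouvilleHcpLiouvilleBlowdownSecantRows

/-!
# `ExcessDecayLiouville.HcpLiouville` (stmt-AtomisticToContinuum-9332), line `Sketch` (skeleton v4): stub `stub_remainder`, part 2

Second helper file of stub `stub_remainder` (interface `Blowdown.RemainderProp` of the blow-down): the NEAR and MID
ranges of the THREE-RANGE estimate of the weighted remainder `G(p,q) = ‖N(p − q, w p − w q)‖ (1 + dist p q)` summed
over `p` in the sites of the closed ball `B_R(c)` and `q` in an arbitrary finite set of sites, for a general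
admissible hcp-like datum `(t, A)` (sites `S = Sites₀ t A`, `23/25`-separated), a field `w` with
`‖w p − w q‖ ≤ 3/20` on `S × S`, and a pointwise bound `‖N(e, d)‖ ≤ C_N ‖e‖⁻⁹ ‖d‖²` (`‖e‖ ≥ 23/25`, `‖d‖ ≤ 3/20`)
taken as a HYPOTHESIS (it is proved with `C_N = 25000` in `…BlowdownRemainderPointwise.lean`):

* `Blowdown.nnEnergy_eq_sum`, `Blowdown.nnEnergy_le_of_le`, `Blowdown.nnPairSum_le_nnEnergy` — `nnEnergy` as a
  finite sum of summable nearest-neighbour rows, its monotonicity in the radius, and the domination of the finite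
  pair sum of `longRange_local_le` (…LongRange.lean) by `nnEnergy`;
* pointwise: `G ≤ C_N dist⁻⁹(1 + dist)‖w p − w q‖²`; NEAR (`dist ≤ 11/10`) `G ≤ 5 C_N ‖w p − w q‖²`;
  LONG (`dist > 11/10`) `G ≤ 2 C_N dist⁻⁸ ‖w p − w q‖²`, FAR `G ≤ (9C_N/200) dist⁻⁸`;
* `Blowdown.remainder_near_sum_le` — NEAR sum `≤ 5 C_N · nnEnergy S w c R`;
* `Blowdown.remainder_mid_sum_le` — MID sum (`11/10 < dist ≤ L₀ = (3R − 20)/10`, empty unless `L₀ > 11/10`)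
  `≤ 8·10⁶ C_N · nnEnergy S w c (4R)` by `longRange_local_le` with `L = L₀ ≥ 1` (outer radius `R + 10L₀ + 20 = 4R`).

The FAR range and the assembly are in `…BlowdownRemainder.lean`.  All `[folklore]`; a `--supports` helper for item
stmt-AtomisticToContinuum-9332, nothing here closes an item.
-/

noncomputable section

namespace Summit.AtomisticToContinuum.Crystallization.Theorems.ExcessDecayLiouville

open scoped BigOperators Topology Classical InnerProductSpace RealInnerProductSpace
open Literature.MathematicalPhysics.StatisticalMechanics
open Summit.AtomisticToContinuum.Crystallization.Theses.ExcessDecayLiouville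
open Summit.AtomisticToContinuum.Crystallization.Theorems.PhononStabilityNegative

namespace Blowdown

open LevelOne

variable {t : Fin 2 → EuclideanSpace ℝ (Fin 3)} {A : EuclideanSpace ℝ (Fin 3) →L[ℝ] EuclideanSpace ℝ (Fin 3)}

/-! ## The nearest-neighbour energy as finite sums -/

/-- The sites of a closed ball: the `Finset` of points is the image of the `Finset` of the site subtype. [folklore] -/
theorem ballFinset_eq_map (hA : Adm₀ A) (hI : Inner₀ t A) (c : EuclideanSpace ℝ (Fin 3)) (X : ℝ) :
    (finite_sites_dist_le hA hI c X).toFinset =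
      (finite_sites_ball hA hI c X).toFinset.map (Function.Embedding.subtype _) := by
  ext x
  simp only [Set.Finite.mem_toFinset, Set.mem_setOf_eq, Finset.mem_map, Function.Embedding.coe_subtype,
    Subtype.exists, exists_and_right, exists_eq_right]
  constructor <;> rintro ⟨h1, h2⟩ <;> exact ⟨h1, h2⟩

/-- Membership in the `Finset` of the sites of a closed ball. [folklore] -/
theorem mem_ballFinset (hA : Adm₀ A) (hI : Inner₀ t A) {c : EuclideanSpace ℝ (Fin 3)} {X : ℝ} {p : Sites₀ t A} :
    p ∈ (finite_sites_ball hA hI c X).toFinset ↔ dist (p : EuclideanSpace ℝ (Fin 3)) c ≤ X := by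
  rw [Set.Finite.mem_toFinset]
  rfl

/-- A nearest-neighbour row `q ↦ [dist p q ≤ 11/10] ‖w p − w q‖²` over the sites is finitely supported, hence
summable. [folklore] -/
theorem summable_nnRow (hA : Adm₀ A) (hI : Inner₀ t A)
    (w : EuclideanSpace ℝ (Fin 3) → EuclideanSpace ℝ (Fin 3)) (p : EuclideanSpace ℝ (Fin 3)) :
    Summable (fun q : Sites₀ t A =>
      if dist p (q : EuclideanSpace ℝ (Fin 3)) ≤ 11 / 10 then ‖w p - w q‖ ^ 2 else (0 : ℝ)) := by
  refine summable_of_ne_finset_zero (s := (finite_sites_ball hA hI p (11 / 10)).toFinset) fun q hq => ?_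
  rw [if_neg]
  intro hd
  exact hq ((Set.Finite.mem_toFinset _).2 (by rw [dist_comm] at hd; exact hd))

/-- `nnEnergy S w c R` as a finite sum over the sites of the ball of the (summable) nearest-neighbour rows.
[folklore] -/
theorem nnEnergy_eq_sum (hA : Adm₀ A) (hI : Inner₀ t A)
    (w : EuclideanSpace ℝ (Fin 3) → EuclideanSpace ℝ (Fin 3)) (c : EuclideanSpace ℝ (Fin 3)) (R : ℝ) :
    nnEnergy (Sites₀ t A) w c R = ∑ p ∈ (finite_sites_ball hA hI c R).toFinset,
      ∑' q : Sites₀ t A, (if dist (p : EuclideanSpace ℝ (Fin 3)) q ≤ 11 / 10 then ‖w p - w q‖ ^ 2 else (0 : ℝ)) := by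
  rw [nnEnergy_eq_tsum_ite, tsum_eq_sum (s := (finite_sites_ball hA hI c R).toFinset)]
  · refine Finset.sum_congr rfl fun p hp => ?_
    rw [if_pos ((mem_ballFinset hA hI).1 hp)]
  · intro p hp
    rw [if_neg (fun h => hp ((mem_ballFinset hA hI).2 h))]

/-- `nnEnergy` is monotone in the radius. [folklore] -/
theorem nnEnergy_le_of_le (hA : Adm₀ A) (hI : Inner₀ t A)
    (w : EuclideanSpace ℝ (Fin 3) → EuclideanSpace ℝ (Fin 3)) (c : EuclideanSpace ℝ (Fin 3)) {R R' : ℝ}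
    (h : R ≤ R') : nnEnergy (Sites₀ t A) w c R ≤ nnEnergy (Sites₀ t A) w c R' := by
  rw [nnEnergy_eq_sum hA hI w c R, nnEnergy_eq_sum hA hI w c R']
  refine Finset.sum_le_sum_of_subset_of_nonneg (fun p hp => ?_)
    (fun p _ _ => tsum_nonneg fun q => by split_ifs <;> positivity)
  rw [mem_ballFinset hA hI] at hp ⊢
  exact le_trans hp h

/-- **The finite pair sum of `longRange_local_le` is dominated by `nnEnergy`**:
`Σ_{p,q ∈ S ∩ B_X} [p ≠ q][dist ≤ 11/10] ‖w p − w q‖² ≤ nnEnergy S w c X`. [folklore] -/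
theorem nnPairSum_le_nnEnergy (hA : Adm₀ A) (hI : Inner₀ t A)
    (w : EuclideanSpace ℝ (Fin 3) → EuclideanSpace ℝ (Fin 3)) (c : EuclideanSpace ℝ (Fin 3)) (X : ℝ) :
    ∑ p ∈ (finite_sites_dist_le hA hI c X).toFinset, ∑ q ∈ (finite_sites_dist_le hA hI c X).toFinset,
        (if p ≠ q ∧ dist p q ≤ 11 / 10 then ‖w p - w q‖ ^ 2 else (0 : ℝ)) ≤
      nnEnergy (Sites₀ t A) w c X := by
  rw [nnEnergy_eq_sum hA hI w c X, ballFinset_eq_map hA hI c X, Finset.sum_map]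
  refine Finset.sum_le_sum fun p _ => ?_
  rw [Finset.sum_map]
  simp only [Function.Embedding.coe_subtype]
  calc ∑ q ∈ (finite_sites_ball hA hI c X).toFinset,
        (if (p : EuclideanSpace ℝ (Fin 3)) ≠ q ∧ dist (p : EuclideanSpace ℝ (Fin 3)) q ≤ 11 / 10 then
          ‖w p - w q‖ ^ 2 else (0 : ℝ))
      ≤ ∑ q ∈ (finite_sites_ball hA hI c X).toFinset,
        (if dist (p : EuclideanSpace ℝ (Fin 3)) q ≤ 11 / 10 then ‖w p - w q‖ ^ 2 else (0 : ℝ)) := by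
          refine Finset.sum_le_sum fun q _ => ?_
          split_ifs with h1 h2
          · exact le_rfl
          · exact (h2 h1.2).elim
          · positivity
          · exact le_rfl
    _ ≤ _ := (summable_nnRow hA hI w p).sum_le_tsum _ (fun q _ => by positivity)

/-! ## Pointwise bounds of the weighted remainder on pairs of sites -/

/-- The weighted remainder against the pointwise bound: for distinct sites `p ≠ q`,
`‖N(p − q, w p − w q)‖(1 + dist p q) ≤ C_N dist⁻⁹ (1 + dist) ‖w p − w q‖²`. [folklore] -/
theorem remainder_weight_le {C_N : ℝ}
    (hN : ∀ e d : EuclideanSpace ℝ (Fin 3), 23 / 25 ≤ ‖e‖ → ‖d‖ ≤ 3 / 20 →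
      ‖ljRemainder e d‖ ≤ C_N * (‖e‖⁻¹) ^ 9 * ‖d‖ ^ 2)
    (hA : Adm₀ A) (hI : Inner₀ t A) {w : EuclideanSpace ℝ (Fin 3) → EuclideanSpace ℝ (Fin 3)}
    (hw : ∀ p ∈ Sites₀ t A, ∀ q ∈ Sites₀ t A, ‖w p - w q‖ ≤ 3 / 20)
    {p q : EuclideanSpace ℝ (Fin 3)} (hp : p ∈ Sites₀ t A) (hq : q ∈ Sites₀ t A) (hpq : p ≠ q) :
    ‖ljRemainder (p - q) (w p - w q)‖ * (1 + dist p q) ≤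
      C_N * (dist p q)⁻¹ ^ 9 * (1 + dist p q) * ‖w p - w q‖ ^ 2 := by
  have hd : 23 / 25 ≤ dist p q := dist_sites_ge hA hI hp hq hpq
  have h := hN (p - q) (w p - w q) (by rwa [← dist_eq_norm]) (hw p hp q hq)
  rw [← dist_eq_norm] at h
  have h1 : 0 ≤ 1 + dist p q := by positivity
  calc _ ≤ C_N * (dist p q)⁻¹ ^ 9 * ‖w p - w q‖ ^ 2 * (1 + dist p q) := mul_le_mul_of_nonneg_right h h1
    _ = _ := by ring

/-- NEAR range: for sites at `dist p q ≤ 11/10`, `‖N‖(1 + dist) ≤ 5 C_N ‖w p − w q‖²`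
(`dist ≥ 23/25`, `(25/23)⁹ · 21/10 ≤ 5`; the diagonal term vanishes). [folklore] -/
theorem remainder_near_le {C_N : ℝ} (hC : 0 ≤ C_N)
    (hN : ∀ e d : EuclideanSpace ℝ (Fin 3), 23 / 25 ≤ ‖e‖ → ‖d‖ ≤ 3 / 20 →
      ‖ljRemainder e d‖ ≤ C_N * (‖e‖⁻¹) ^ 9 * ‖d‖ ^ 2)
    (hA : Adm₀ A) (hI : Inner₀ t A) {w : EuclideanSpace ℝ (Fin 3) → EuclideanSpace ℝ (Fin 3)}
    (hw : ∀ p ∈ Sites₀ t A, ∀ q ∈ Sites₀ t A, ‖w p - w q‖ ≤ 3 / 20)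
    {p q : EuclideanSpace ℝ (Fin 3)} (hp : p ∈ Sites₀ t A) (hq : q ∈ Sites₀ t A) (hd : dist p q ≤ 11 / 10) :
    ‖ljRemainder (p - q) (w p - w q)‖ * (1 + dist p q) ≤ 5 * C_N * ‖w p - w q‖ ^ 2 := by
  rcases eq_or_ne p q with rfl | hpq
  · have h0 : ljRemainder (p - p) (w p - w p) = 0 := by simp [ljRemainder, ljForce]
    rw [h0, norm_zero, zero_mul]
    positivity
  · have h := remainder_weight_le hN hA hI hw hp hq hpq
    have hd0 : 23 / 25 ≤ dist p q := dist_sites_ge hA hI hp hq hpq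
    have hinv : (dist p q)⁻¹ ≤ 25 / 23 := inv_le_of_inv_le₀ (by norm_num) (by norm_num; exact hd0)
    have h9 : (dist p q)⁻¹ ^ 9 ≤ (25 / 23) ^ 9 := pow_le_pow_left₀ (inv_nonneg.2 dist_nonneg) hinv 9
    have h21 : 1 + dist p q ≤ 21 / 10 := by linarith
    have hX : 0 ≤ C_N * ‖w p - w q‖ ^ 2 := mul_nonneg hC (sq_nonneg _)
    have hnum : (25 / 23 : ℝ) ^ 9 * (21 / 10) ≤ 5 := by norm_num
    calc _ ≤ C_N * (dist p q)⁻¹ ^ 9 * (1 + dist p q) * ‖w p - w q‖ ^ 2 := h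
      _ = ((dist p q)⁻¹ ^ 9 * (1 + dist p q)) * (C_N * ‖w p - w q‖ ^ 2) := by ring
      _ ≤ ((25 / 23 : ℝ) ^ 9 * (21 / 10)) * (C_N * ‖w p - w q‖ ^ 2) := by
          refine mul_le_mul_of_nonneg_right ?_ hX
          exact mul_le_mul h9 h21 (by positivity) (by positivity)
      _ ≤ 5 * (C_N * ‖w p - w q‖ ^ 2) := mul_le_mul_of_nonneg_right hnum hX
      _ = _ := by ring

/-- LONG range: for sites at `dist p q > 11/10` (so `dist ≥ 1`), `‖N‖(1 + dist) ≤ 2 C_N dist⁻⁸ ‖w p − w q‖²`.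
[folklore] -/
theorem remainder_long_le {C_N : ℝ} (hC : 0 ≤ C_N)
    (hN : ∀ e d : EuclideanSpace ℝ (Fin 3), 23 / 25 ≤ ‖e‖ → ‖d‖ ≤ 3 / 20 →
      ‖ljRemainder e d‖ ≤ C_N * (‖e‖⁻¹) ^ 9 * ‖d‖ ^ 2)
    (hA : Adm₀ A) (hI : Inner₀ t A) {w : EuclideanSpace ℝ (Fin 3) → EuclideanSpace ℝ (Fin 3)}
    (hw : ∀ p ∈ Sites₀ t A, ∀ q ∈ Sites₀ t A, ‖w p - w q‖ ≤ 3 / 20)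
    {p q : EuclideanSpace ℝ (Fin 3)} (hp : p ∈ Sites₀ t A) (hq : q ∈ Sites₀ t A) (hd : 11 / 10 < dist p q) :
    ‖ljRemainder (p - q) (w p - w q)‖ * (1 + dist p q) ≤ 2 * C_N * (dist p q)⁻¹ ^ 8 * ‖w p - w q‖ ^ 2 := by
  have hpq : p ≠ q := by
    rintro rfl
    rw [dist_self] at hd
    norm_num at hd
  have h := remainder_weight_le hN hA hI hw hp hq hpq
  have hd1 : 1 ≤ dist p q := by linarith
  have hdpos : 0 < dist p q := by linarith
  have hi1 : (dist p q)⁻¹ ≤ 1 := inv_le_one_of_one_le₀ hd1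
  have hkey : (dist p q)⁻¹ ^ 9 * (1 + dist p q) ≤ 2 * (dist p q)⁻¹ ^ 8 := by
    have hm : (dist p q)⁻¹ * dist p q = 1 := inv_mul_cancel₀ hdpos.ne'
    have heq : (dist p q)⁻¹ ^ 9 * (1 + dist p q) = (dist p q)⁻¹ ^ 8 * ((dist p q)⁻¹ + (dist p q)⁻¹ * dist p q) := by
      ring
    rw [heq, hm]
    have h8 : 0 ≤ (dist p q)⁻¹ ^ 8 := by positivity
    nlinarith
  have hX : 0 ≤ C_N * ‖w p - w q‖ ^ 2 := mul_nonneg hC (sq_nonneg _)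
  calc _ ≤ C_N * (dist p q)⁻¹ ^ 9 * (1 + dist p q) * ‖w p - w q‖ ^ 2 := h
    _ = ((dist p q)⁻¹ ^ 9 * (1 + dist p q)) * (C_N * ‖w p - w q‖ ^ 2) := by ring
    _ ≤ (2 * (dist p q)⁻¹ ^ 8) * (C_N * ‖w p - w q‖ ^ 2) := mul_le_mul_of_nonneg_right hkey hX
    _ = _ := by ring

/-- FAR range: for sites at `dist p q > 11/10`, with `‖w p − w q‖ ≤ 3/20`,
`‖N‖(1 + dist) ≤ (9 C_N / 200) dist⁻⁸`. [folklore] -/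
theorem remainder_far_le {C_N : ℝ} (hC : 0 ≤ C_N)
    (hN : ∀ e d : EuclideanSpace ℝ (Fin 3), 23 / 25 ≤ ‖e‖ → ‖d‖ ≤ 3 / 20 →
      ‖ljRemainder e d‖ ≤ C_N * (‖e‖⁻¹) ^ 9 * ‖d‖ ^ 2)
    (hA : Adm₀ A) (hI : Inner₀ t A) {w : EuclideanSpace ℝ (Fin 3) → EuclideanSpace ℝ (Fin 3)}
    (hw : ∀ p ∈ Sites₀ t A, ∀ q ∈ Sites₀ t A, ‖w p - w q‖ ≤ 3 / 20)
    {p q : EuclideanSpace ℝ (Fin 3)} (hp : p ∈ Sites₀ t A) (hq : q ∈ Sites₀ t A) (hd : 11 / 10 < dist p q) :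
    ‖ljRemainder (p - q) (w p - w q)‖ * (1 + dist p q) ≤ 9 * C_N / 200 * (dist p q)⁻¹ ^ 8 := by
  have h := remainder_long_le hC hN hA hI hw hp hq hd
  have h2 : ‖w p - w q‖ ^ 2 ≤ (3 / 20) ^ 2 := pow_le_pow_left₀ (norm_nonneg _) (hw p hp q hq) 2
  have hY : 0 ≤ 2 * C_N * (dist p q)⁻¹ ^ 8 := by positivity
  calc _ ≤ 2 * C_N * (dist p q)⁻¹ ^ 8 * ‖w p - w q‖ ^ 2 := h
    _ ≤ 2 * C_N * (dist p q)⁻¹ ^ 8 * (3 / 20) ^ 2 := mul_le_mul_of_nonneg_left h2 hY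
    _ = _ := by ring

/-! ## The NEAR and MID range sums -/

/-- **NEAR sum**: `Σ_{p ∈ S ∩ B_R} Σ_{q ∈ V} [dist ≤ 11/10] ‖N‖(1 + dist) ≤ 5 C_N · nnEnergy S w c R`. [folklore] -/
theorem remainder_near_sum_le {C_N : ℝ} (hC : 0 ≤ C_N)
    (hN : ∀ e d : EuclideanSpace ℝ (Fin 3), 23 / 25 ≤ ‖e‖ → ‖d‖ ≤ 3 / 20 →
      ‖ljRemainder e d‖ ≤ C_N * (‖e‖⁻¹) ^ 9 * ‖d‖ ^ 2)
    (hA : Adm₀ A) (hI : Inner₀ t A) {w : EuclideanSpace ℝ (Fin 3) → EuclideanSpace ℝ (Fin 3)}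
    (hw : ∀ p ∈ Sites₀ t A, ∀ q ∈ Sites₀ t A, ‖w p - w q‖ ≤ 3 / 20)
    (c : EuclideanSpace ℝ (Fin 3)) (R : ℝ) (V : Finset (Sites₀ t A)) :
    ∑ p ∈ (finite_sites_ball hA hI c R).toFinset, ∑ q ∈ V,
        (if dist (p : EuclideanSpace ℝ (Fin 3)) q ≤ 11 / 10 then
          ‖ljRemainder ((p : EuclideanSpace ℝ (Fin 3)) - q) (w p - w q)‖ * (1 + dist (p : EuclideanSpace ℝ (Fin 3)) q)
        else (0 : ℝ)) ≤
      5 * C_N * nnEnergy (Sites₀ t A) w c R := by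
  rw [nnEnergy_eq_sum hA hI w c R, Finset.mul_sum]
  refine Finset.sum_le_sum fun p _ => ?_
  have h5 : 0 ≤ 5 * C_N := by positivity
  calc ∑ q ∈ V, (if dist (p : EuclideanSpace ℝ (Fin 3)) q ≤ 11 / 10 then
          ‖ljRemainder ((p : EuclideanSpace ℝ (Fin 3)) - q) (w p - w q)‖ * (1 + dist (p : EuclideanSpace ℝ (Fin 3)) q)
          else (0 : ℝ))
      ≤ ∑ q ∈ V, 5 * C_N * (if dist (p : EuclideanSpace ℝ (Fin 3)) q ≤ 11 / 10 then ‖w p - w q‖ ^ 2 else (0 : ℝ)) := by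
        refine Finset.sum_le_sum fun q _ => ?_
        split_ifs with h
        · exact remainder_near_le hC hN hA hI hw p.2 q.2 h
        · simp
    _ = 5 * C_N * ∑ q ∈ V, (if dist (p : EuclideanSpace ℝ (Fin 3)) q ≤ 11 / 10 then ‖w p - w q‖ ^ 2 else (0 : ℝ)) := by
        rw [Finset.mul_sum]
    _ ≤ 5 * C_N * ∑' q : Sites₀ t A,
          (if dist (p : EuclideanSpace ℝ (Fin 3)) q ≤ 11 / 10 then ‖w p - w q‖ ^ 2 else (0 : ℝ)) :=
        mul_le_mul_of_nonneg_left ((summable_nnRow hA hI w p).sum_le_tsum V (fun q _ => by positivity)) h5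

/-- **MID sum**: with `L₀ = (3R − 20)/10`,
`Σ_{p ∈ S ∩ B_R} Σ_{q ∈ V} [11/10 < dist ≤ L₀] ‖N‖(1 + dist) ≤ 8·10⁶ C_N · nnEnergy S w c (4R)`
(empty unless `L₀ > 11/10`; then `longRange_local_le` with `L = L₀ ≥ 1`, outer radius `R + 10L₀ + 20 = 4R`).
[folklore] -/
theorem remainder_mid_sum_le {C_N : ℝ} (hC : 0 ≤ C_N)
    (hN : ∀ e d : EuclideanSpace ℝ (Fin 3), 23 / 25 ≤ ‖e‖ → ‖d‖ ≤ 3 / 20 →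
      ‖ljRemainder e d‖ ≤ C_N * (‖e‖⁻¹) ^ 9 * ‖d‖ ^ 2)
    (hA : Adm₀ A) (hI : Inner₀ t A) {w : EuclideanSpace ℝ (Fin 3) → EuclideanSpace ℝ (Fin 3)}
    (hw : ∀ p ∈ Sites₀ t A, ∀ q ∈ Sites₀ t A, ‖w p - w q‖ ≤ 3 / 20)
    (c : EuclideanSpace ℝ (Fin 3)) (R : ℝ) (V : Finset (Sites₀ t A)) :
    ∑ p ∈ (finite_sites_ball hA hI c R).toFinset, ∑ q ∈ V,
        (if 11 / 10 < dist (p : EuclideanSpace ℝ (Fin 3)) q ∧ dist (p : EuclideanSpace ℝ (Fin 3)) q ≤ (3 * R - 20) / 10 then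
          ‖ljRemainder ((p : EuclideanSpace ℝ (Fin 3)) - q) (w p - w q)‖ * (1 + dist (p : EuclideanSpace ℝ (Fin 3)) q)
        else (0 : ℝ)) ≤
      8000000 * C_N * nnEnergy (Sites₀ t A) w c (4 * R) := by
  set L₀ : ℝ := (3 * R - 20) / 10 with hL₀
  have hnn0 : 0 ≤ nnEnergy (Sites₀ t A) w c (4 * R) := nnEnergy_nonneg _ _ _ _
  by_cases hL : 11 / 10 < L₀
  swap
  · -- the range is empty
    have h0 : ∀ p ∈ (finite_sites_ball hA hI c R).toFinset, ∑ q ∈ V,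
        (if 11 / 10 < dist (p : EuclideanSpace ℝ (Fin 3)) q ∧ dist (p : EuclideanSpace ℝ (Fin 3)) q ≤ L₀ then
          ‖ljRemainder ((p : EuclideanSpace ℝ (Fin 3)) - q) (w p - w q)‖ * (1 + dist (p : EuclideanSpace ℝ (Fin 3)) q)
          else (0 : ℝ)) = 0 := by
      intro p _
      refine Finset.sum_eq_zero fun q _ => ?_
      rw [if_neg]
      rintro ⟨h1, h2⟩
      exact hL (lt_of_lt_of_le h1 h2)
    rw [Finset.sum_eq_zero h0]
    positivity
  -- the nontrivial case: `L₀ > 11/10`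
  have hL1 : 1 ≤ L₀ := by linarith
  -- the summand of `longRange_local_le`
  set F : EuclideanSpace ℝ (Fin 3) → EuclideanSpace ℝ (Fin 3) → ℝ := fun p q =>
    (if p ≠ q ∧ dist p q ≤ L₀ then (dist p q)⁻¹ ^ 8 * ‖w p - w q‖ ^ 2 else (0 : ℝ)) with hF
  have hF0 : ∀ p q, 0 ≤ F p q := fun p q => by simp only [hF]; split_ifs <;> positivity
  -- termwise domination
  have hterm : ∀ p ∈ (finite_sites_ball hA hI c R).toFinset, ∀ q ∈ V,
      (if 11 / 10 < dist (p : EuclideanSpace ℝ (Fin 3)) q ∧ dist (p : EuclideanSpace ℝ (Fin 3)) q ≤ L₀ then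
          ‖ljRemainder ((p : EuclideanSpace ℝ (Fin 3)) - q) (w p - w q)‖ * (1 + dist (p : EuclideanSpace ℝ (Fin 3)) q)
          else (0 : ℝ)) ≤ 2 * C_N * F p q := by
    intro p _ q _
    split_ifs with h
    · have hne : (p : EuclideanSpace ℝ (Fin 3)) ≠ q := by
        intro hpq
        rw [hpq, dist_self] at h
        norm_num at h
      have h1 := remainder_long_le hC hN hA hI hw p.2 q.2 h.1
      simp only [hF, if_pos (And.intro hne h.2)]
      calc _ ≤ 2 * C_N * (dist (p : EuclideanSpace ℝ (Fin 3)) q)⁻¹ ^ 8 * ‖w p - w q‖ ^ 2 := h1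
        _ = _ := by ring
    · exact mul_nonneg (by positivity) (hF0 _ _)
  -- inner sums: every partner within range lies in the ball of radius `R + L₀`
  have hinner : ∀ p ∈ (finite_sites_ball hA hI c R).toFinset,
      ∑ q ∈ V, F p q ≤ ∑ q ∈ (finite_sites_dist_le hA hI c (R + L₀)).toFinset, F p q := by
    intro p hp
    have hpR : dist (p : EuclideanSpace ℝ (Fin 3)) c ≤ R := (mem_ballFinset hA hI).1 hp
    have hmap : ∑ q ∈ V, F p q = ∑ x ∈ V.map (Function.Embedding.subtype _), F p x := by
      rw [Finset.sum_map]
      rfl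
    rw [hmap, ← Finset.sum_filter_of_ne (p := fun q => dist (p : EuclideanSpace ℝ (Fin 3)) q ≤ L₀)]
    · refine Finset.sum_le_sum_of_subset_of_nonneg (fun q hq => ?_) (fun q _ _ => hF0 _ _)
      rw [Finset.mem_filter, Finset.mem_map] at hq
      obtain ⟨⟨q', _, rfl⟩, hqL⟩ := hq
      rw [Set.Finite.mem_toFinset]
      refine ⟨q'.2, ?_⟩
      simp only [Function.Embedding.coe_subtype] at hqL ⊢
      have := dist_triangle (q' : EuclideanSpace ℝ (Fin 3)) p c
      rw [dist_comm (q' : EuclideanSpace ℝ (Fin 3)) p] at this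
      linarith
    · intro q _ hq
      by_contra hcon
      apply hq
      simp only [hF]
      rw [if_neg (fun h => hcon h.2)]
  -- the outer sum, reindexed over the `Finset` of points
  have houter : ∑ p ∈ (finite_sites_ball hA hI c R).toFinset,
      ∑ q ∈ (finite_sites_dist_le hA hI c (R + L₀)).toFinset, F p q =
      ∑ p ∈ (finite_sites_dist_le hA hI c R).toFinset,
        ∑ q ∈ (finite_sites_dist_le hA hI c (R + L₀)).toFinset, F p q := by
    rw [ballFinset_eq_map hA hI c R, Finset.sum_map]
    rfl
  have hLR := longRange_local_le hA hI w c (R := R) hL1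
  have hrad : R + 10 * L₀ + 20 ≤ 4 * R := by rw [hL₀]; linarith
  have hmono := nnEnergy_mono hA hI w c hrad
  have hNN := nnPairSum_le_nnEnergy hA hI w c (4 * R)
  calc ∑ p ∈ (finite_sites_ball hA hI c R).toFinset, ∑ q ∈ V,
        (if 11 / 10 < dist (p : EuclideanSpace ℝ (Fin 3)) q ∧ dist (p : EuclideanSpace ℝ (Fin 3)) q ≤ L₀ then
          ‖ljRemainder ((p : EuclideanSpace ℝ (Fin 3)) - q) (w p - w q)‖ * (1 + dist (p : EuclideanSpace ℝ (Fin 3)) q)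
          else (0 : ℝ))
      ≤ ∑ p ∈ (finite_sites_ball hA hI c R).toFinset, ∑ q ∈ V, 2 * C_N * F p q :=
        Finset.sum_le_sum fun p hp => Finset.sum_le_sum fun q hq => hterm p hp q hq
    _ = 2 * C_N * ∑ p ∈ (finite_sites_ball hA hI c R).toFinset, ∑ q ∈ V, F p q := by
        rw [Finset.mul_sum]
        refine Finset.sum_congr rfl fun p _ => ?_
        rw [Finset.mul_sum]
    _ ≤ 2 * C_N * ∑ p ∈ (finite_sites_ball hA hI c R).toFinset,
          ∑ q ∈ (finite_sites_dist_le hA hI c (R + L₀)).toFinset, F p q :=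
        mul_le_mul_of_nonneg_left (Finset.sum_le_sum hinner) (by positivity)
    _ = 2 * C_N * ∑ p ∈ (finite_sites_dist_le hA hI c R).toFinset,
          ∑ q ∈ (finite_sites_dist_le hA hI c (R + L₀)).toFinset, F p q := by rw [houter]
    _ ≤ 2 * C_N * (4000000 * ∑ p ∈ (finite_sites_dist_le hA hI c (R + 10 * L₀ + 20)).toFinset,
          ∑ q ∈ (finite_sites_dist_le hA hI c (R + 10 * L₀ + 20)).toFinset,
            (if p ≠ q ∧ dist p q ≤ 11 / 10 then ‖w p - w q‖ ^ 2 else (0 : ℝ))) :=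
        mul_le_mul_of_nonneg_left hLR (by positivity)
    _ ≤ 2 * C_N * (4000000 * ∑ p ∈ (finite_sites_dist_le hA hI c (4 * R)).toFinset,
          ∑ q ∈ (finite_sites_dist_le hA hI c (4 * R)).toFinset,
            (if p ≠ q ∧ dist p q ≤ 11 / 10 then ‖w p - w q‖ ^ 2 else (0 : ℝ))) := by
        gcongr
    _ ≤ 2 * C_N * (4000000 * nnEnergy (Sites₀ t A) w c (4 * R)) := by gcongr
    _ = _ := by ring

end Blowdown

/-- Registered sub-goal carrying this helper file (crux stmt-AtomisticToContinuum-9332, line `Sketch`, skeleton v4,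
stub `stub_remainder`, part 2): the MID-range sum of the weighted pair-force remainder over the sites of a ball is
dominated by the nearest-neighbour energy at radius `4R` (via `longRange_local_le`), for a field with differences
`≤ 3/20` and a pointwise remainder bound with constant `C_N`. [folklore] -/
theorem blowdown_remainderMidSum : ∀ (C_N : ℝ) (t : Fin 2 → EuclideanSpace ℝ (Fin 3))
    (A : EuclideanSpace ℝ (Fin 3) →L[ℝ] EuclideanSpace ℝ (Fin 3))
    (w : EuclideanSpace ℝ (Fin 3) → EuclideanSpace ℝ (Fin 3)) (hA : Adm₀ A) (hI : Inner₀ t A), 0 ≤ C_N →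
    (∀ e d : EuclideanSpace ℝ (Fin 3), 23 / 25 ≤ ‖e‖ → ‖d‖ ≤ 3 / 20 →
      ‖Blowdown.ljRemainder e d‖ ≤ C_N * (‖e‖⁻¹) ^ 9 * ‖d‖ ^ 2) →
    (∀ p ∈ Sites₀ t A, ∀ q ∈ Sites₀ t A, ‖w p - w q‖ ≤ 3 / 20) →
    ∀ (c : EuclideanSpace ℝ (Fin 3)) (R : ℝ) (V : Finset (Sites₀ t A)),
      ∑ p ∈ (LevelOne.finite_sites_ball hA hI c R).toFinset, ∑ q ∈ V,
        (if 11 / 10 < dist (p : EuclideanSpace ℝ (Fin 3)) q ∧ dist (p : EuclideanSpace ℝ (Fin 3)) q ≤ (3 * R - 20) / 10 then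
          ‖Blowdown.ljRemainder ((p : EuclideanSpace ℝ (Fin 3)) - q) (w p - w q)‖ * (1 + dist (p : EuclideanSpace ℝ (Fin 3)) q)
        else (0 : ℝ)) ≤
      8000000 * C_N * Blowdown.nnEnergy (Sites₀ t A) w c (4 * R) :=
  fun _ _ _ _ hA hI hC hN hw c R V => Blowdown.remainder_mid_sum_le hC hN hA hI hw c R V

end Summit.AtomisticToContinuum.Crystallization.Theorems.ExcessDecayLiouville

end
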